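import Summits.BirchSwinnertonDyer.BirchSwinnertonDyer.Theorems.RamifiedHeegnerPairTwistUnitAdditive
import HarnessLib

/-!
# U₁ / U₀ at the single-ADDITIVE-carrier Gss2 classes — part F: `432900br1`

Continuation of `…Theorems.RamifiedHeegnerPairTwistUnitAdditive` (seat `bsd-trib-w-rhp` g13; the doors `twistUnit[Zero]TwoSplit_of_sqrtField` and the
full framing are there): per rank-one curve `subGss_three_<label>` (Addv ∧ SubGss at `3` in the kernel), `tamRowZ_/tamagawaProduct_<label>` (`∏ c_ℓ` in the
kernel), `localTamagawa_<q>_<label>` (`c(E/ℚ_q) = 3` in the kernel, the `hmono` input), Kraus minimality of `V = E^{(-3)}_min` and of the twist model `Wd`,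
and `u1_at_/u0_at_<label> : … → MissingUpperBoundAt W 3` by rhp-p2 g9 §4 / §4₀ (`RamifiedPairUpperBound.leafRank{One,Zero}Upper_three_monoCarrierAny_of_namedFacts_…`)
with print + the three named facts `h37 hPT hF1` as hypotheses and `hN hr Dt hc` + the twist `L`-data + `#Ш(Wd)_an` DISPLAYED (+ `bsd3_at_<label>` where the
lower half is free).  **HONEST FRAMING: theorems only; per-curve certificates under DISPLAYED inputs (conductor, analytic rank, `3 ∤ c(Dt)`, twist `L`-data, `#Ш(Wd)_an`) and
the printed / named facts of the road as hypotheses; nothing is booked, no item is closed; U₁ (26022) / U₀ (26024) / TU / L₀ / L₁ stay OPEN class-wide; BSD is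
NOT proved for any curve by this file.**
[cite: MatarNekovar2019, Thm. 0.7 (p. 456)] [cite: GrossZagier1986, Thm. I.(6.3) and (7.3)] [cite: GrossLMS1991, §1 and Prop. 3.7]
[cite: KrizLi2019, Thm. 1.20] [cite: Silverman1994, IV.9.4] [cite: Tate1975, §7] [cite: Kraus1989, Prop. 1] [cite: Cremona2006, Table 1]
[cite: SilvermanAEC2009, C.11 (CM j-invariants)]
-/

set_option linter.dupNamespace false
set_option autoImplicit false

noncomputable section

open scoped Classical NumberField

open WeierstrassCurve NumberField IsDedekindDomain IsDedekindDomain.HeightOneSpectrum Rat.HeightOneSpectrum Field Literature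
  Literature.NumberTheory.DiophantineGeometry Literature.NumberTheory.EllipticCurves Literature.NumberTheory.EllipticCurves.ModularForms
  Literature.NumberTheory.EllipticCurves.Rank1Residual Literature.NumberTheory.EllipticCurves.Rank1Residual.Typed Literature.NumberTheory.Automorphic
  Literature.NumberTheory.EllipticCurves.Rank1Residual.X11RankOneCertificates Literature.NumberTheory.EllipticCurves.KrizLi2019
  Literature.NumberTheory.GaloisRepresentations Literature.NumberTheory.QuadraticFields Summit.BirchSwinnertonDyer.BirchSwinnertonDyer.Rank1Residual.IntModel
  Summit.BirchSwinnertonDyer.BirchSwinnertonDyer.Rank2Observatory.Tam Summit.BirchSwinnertonDyer.Rank1Residual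
  Summit.BirchSwinnertonDyer.Rank1Residual.Additive Summit.BirchSwinnertonDyer.Rank1Residual.X11b Summit.BirchSwinnertonDyer.Rank1Residual.X11b.Three
  Summit.BirchSwinnertonDyer.Rank1Residual.GaloisImage Summit.BirchSwinnertonDyer.Rank1Residual.Supersingular
  Summit.BirchSwinnertonDyer.BirchSwinnertonDyer.Theses.RamifiedHeegnerPair Summit.BirchSwinnertonDyer.BirchSwinnertonDyer.Theorems
  Summit.BirchSwinnertonDyer.BirchSwinnertonDyer.Theorems.SchneiderFree Summit.BirchSwinnertonDyer.BirchSwinnertonDyer.Theorems.RamifiedPairUpperBound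
  Summit.BirchSwinnertonDyer.BirchSwinnertonDyer.Theorems.RamifiedHeegnerPairStepLIntrinsic
  Summit.BirchSwinnertonDyer.BirchSwinnertonDyer.Theorems.AdditiveBranchIMCGordTwoRankOne.HeegnerKolyvagin
  Summit.BirchSwinnertonDyer.BirchSwinnertonDyer.Theorems.RamifiedHeegnerPairTwistUnitIntrinsic

namespace Summit.BirchSwinnertonDyer.BirchSwinnertonDyer.Theorems.RamifiedHeegnerPairTwistUnitAdditive

/-! ## §10 `432900br1` = `[0, 0, 0, -3600, -45900]`, `N = 432900 = 2^2·3^2·5^2·13·37` (`2`: IV*, `c = 1`, `3`: I₀*, `c = 1`, `5`: IV, `c = 3`, `13`: I1, `c = 1`, `37`: I2, `c = 2`); `∏ c_ℓ = 6`, single carrier `q = 5` (IV, ADDITIVE, `c_5 = 3`);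
`r_an = 1`, `#E(ℚ)_tors = 1`, `#Ш(E)_an = 1` (Cremona/LMFDB, displayed where used); class `432900br` of size 1.
`V = E^{(-3)}_min = [0, 0, 0, -400, 1700]` (`#Ṽ(𝔽₃) = 1`), `K = ℚ(√-1439)`, `Wd = E^{(-1439)}_min = [0, 0, 0, -7454595600, 136771329122100]`: `L(E^{(-1439)},1) = 1.8983085790 ≠ 0` (g11 TU census kit j308272: PARI `ellL1`, and EXACTLY `L(F,1)/Ω⁺ = 96` by Sage modular symbols for the class), `#Ш(Wd)_an = L/(Ω·∏c/T²) = 4` (`N(Wd) = 896415120900 = N·1439²`, root number `1`, `∏c(Wd) = 24`, `#Wd(ℚ)_tors = 1`; BSD data of `Wd` by kit j312919, PARI 2.15.4). -/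

/-- `V = [0, 0, 0, -400, 1700]` (the minimal model of `432900br1^{(-3)}`, conductor `48100`): `Δ ≠ 0` in the kernel. [cite: Cremona2006, Table 1 (Cremona label 432900br1)] -/
theorem isElliptic_sV432900br1 : (⟨0, 0, 0, -400, 1700⟩ : WeierstrassCurve ℚ).IsElliptic :=
  isElliptic_of_discOf_ne_zero 0 0 0 (-400) 1700 (by decide +kernel)

/-- `V` is globally minimal: `|Δ| = 2^8·5^4·13·37^2` kernel-checked, Kraus' criterion prime by prime. [cite: Kraus1989, Prop. 1 and Prop. 2]
[cite: SilvermanAEC2009, VII.1 Remark 1.1] [cite: Cremona2006, Table 1 (Cremona label 432900br1)] -/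
theorem isGloballyMinimal_sV432900br1 : (⟨0, 0, 0, -400, 1700⟩ : WeierstrassCurve ℚ).IsGloballyMinimal :=
  isGloballyMinimal_of_krausCriterion₃_factored 0 0 0 (-400) 1700
    [(2, 8), (5, 4), (13, 1), (37, 2)] (by decide +kernel)
    (by intro qe hqe; simp only [List.mem_cons, List.not_mem_nil, or_false] at hqe
        rcases hqe with rfl | rfl | rfl | rfl <;> norm_num)
    (by set_option synthInstance.maxSize 2000 in decide +kernel)

/-- **`432900br1` is ADDITIVE at `3` and on the cell (G) ∧ ss, IN THE KERNEL**: `3 ∣ Δ`, `3 ∣ c₄`; `C • V^{(-3)} = E` (`[u, r, s, t] = [1, 0, 0, 0]`) with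
`V` globally minimal, `3 ∤ Δ(V)`, `#Ṽ(𝔽₃) = 1` (`a₃(V) = 3`, supersingular), whence `TypeG`, `SubGord`, `SubGss` at `3` as in the k1 records.
[cite: SilvermanAEC2009, VII.5 Prop. 5.1 (a), (c)] [cite: Delbourgo1998, §1.5 (G)] [cite: Cremona2006, Table 1 (Cremona label 432900br1)] -/
theorem subGss_three_432900br1 {W : WeierstrassCurve ℚ} [W.IsElliptic] [W.IsGloballyMinimal] (hWeq : W = (⟨0, 0, 0, -3600, -45900⟩ : WeierstrassCurve ℚ)) :
    Addv W 3 ∧ SubGss W 3 := by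
  subst hWeq
  haveI := isElliptic_sV432900br1
  haveI := isGloballyMinimal_sV432900br1
  have hIW : integralModelInt (⟨0, 0, 0, -3600, -45900⟩ : WeierstrassCurve ℚ) = (⟨0, 0, 0, -3600, -45900⟩ : WeierstrassCurve ℤ) :=
    integralModelInt_eq_of_map_eq _ (map_mk_int 0 0 0 (-3600) (-45900))
  have hadd : Addv (⟨0, 0, 0, -3600, -45900⟩ : WeierstrassCurve ℚ) 3 := Additive.addv_of_intModel hIW 3 (by decide +kernel) (by decide +kernel)
  have hIV : integralModelInt (⟨0, 0, 0, -400, 1700⟩ : WeierstrassCurve ℚ) = (⟨0, 0, 0, -400, 1700⟩ : WeierstrassCurve ℤ) :=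
    integralModelInt_eq_of_map_eq _ (map_mk_int 0 0 0 (-400) 1700)
  have hcV : Nat.card ((((⟨0, 0, 0, -400, 1700⟩ : WeierstrassCurve ℤ)).map (Int.castRingHom (ZMod 3))).toAffine.Point) = 1 := by
    have h := natCard_point_eq_countPoints 0 0 0 (-400) 1700 3 (by norm_num) (by decide +kernel)
    have h' : countPoints [0, 0, 0, -400, 1700] 3 = 1 := countPoints_eq_of_fast (by decide +kernel)
    exact_mod_cast h.trans h'
  have hgood : GoodSS (⟨0, 0, 0, -400, 1700⟩ : WeierstrassCurve ℚ) 3 := Supersingular.goodSS_of_intModel 3 hIV (by decide +kernel) hcV (by decide)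
  have hVW : (⟨1, (0 : ℚ), (0 : ℚ), (0 : ℚ)⟩ : VariableChange ℚ) • (⟨0, 0, 0, -400, 1700⟩ : WeierstrassCurve ℚ).quadraticTwist (-3) =
      (⟨0, 0, 0, -3600, -45900⟩ : WeierstrassCurve ℚ) := by
    ext <;> simp [WeierstrassCurve.variableChange_a₁, WeierstrassCurve.variableChange_a₂,
      WeierstrassCurve.variableChange_a₃, WeierstrassCurve.variableChange_a₄, WeierstrassCurve.variableChange_a₆,
      WeierstrassCurve.quadraticTwist, WeierstrassCurve.b₂, WeierstrassCurve.b₄, WeierstrassCurve.b₆] <;> norm_num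
  obtain ⟨C, hC⟩ := exists_variableChange_quadraticTwist_symm (⟨0, 0, 0, -3600, -45900⟩ : WeierstrassCurve ℚ)
    (⟨0, 0, 0, -400, 1700⟩ : WeierstrassCurve ℚ) (d := (-3 : ℚ)) (by norm_num) ⟨_, hVW⟩
  have hC' : C • (⟨0, 0, 0, -3600, -45900⟩ : WeierstrassCurve ℚ).quadraticTwist ((-1 : ℚ) ^ ((3 : ℕ) / 2) * (3 : ℕ)) =
      (⟨0, 0, 0, -400, 1700⟩ : WeierstrassCurve ℚ) := by
    rw [O5.pstar_three]; exact hC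
  have hG : TypeG (⟨0, 0, 0, -3600, -45900⟩ : WeierstrassCurve ℚ) 3 := (typeG_three_iff_good_twist _ hadd _ C hC').mpr hgood.1
  exact ⟨hadd, (O5.subGss_three_iff_subGord_and_goodSS_twist _ hadd _ C hC).mpr
    ⟨subGord_three_of_typeG_of_addv _ hG hadd, hgood⟩⟩

/-- Row certificate of `432900br1` (stage-1 `TamLocal` at every bad prime, stage-2 `TamX` at the `IV`/`IV*` primes, stage-3 `TamZ` at the `I₀*`/`Iₙ*` primes):
checks in the kernel; emitted by n1011-p03 `tools/tamcert.py`, unchanged. [cite: Silverman1994, IV.9.4 Steps 2–7] [cite: Tate1975, §7] [cite: Cremona2006, Table 1 (Cremona label 432900br1)] -/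
theorem tamRowZ_432900br1 :
    TamZ.rowCheckZ [⟨2, 1, 5, 0, 0, 0, 2, 8, 8, 0, 1⟩, ⟨3, 1, 5, 0, 0, 0, 0, 6, 6, 0, 1⟩, ⟨5, 2, 4, 0, 0, 0, 0, 4, 4, 2, 3⟩, ⟨13, 3, 3, 0, 0, 0, 0, 1, 0, 0, 1⟩, ⟨37, 6, 1, 30, 0, 0, 0, 2, 0, 0, 2⟩]
      [⟨2, 1, 4, 0, 0, 2, 8, 0⟩, ⟨5, 2, 1, 0, 0, 0, 4, 2⟩] [⟨3, 9, 0, 0, 0, 6, 0, 0⟩] (⟨0, 0, 0, -3600, -45900⟩ : WeierstrassCurve ℤ) = true := by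
  decide +kernel

/-- **`∏_ℓ c_ℓ(432900br1) = 6` IN THE KERNEL** for any globally minimal `W / ℚ` with this integral model (Cremona: `6`; `ord₃ = 1`). [cite: Silverman1994, IV.9.4] -/
theorem tamagawaProduct_432900br1 {W : WeierstrassCurve ℚ} [W.IsGloballyMinimal]
    (hI : integralModelInt W = (⟨0, 0, 0, -3600, -45900⟩ : WeierstrassCurve ℤ)) : W.tamagawaProduct = 6 :=
  (IntModelTam.tamagawaProduct_eq_rowValueZ_of_intModel hI tamRowZ_432900br1 (by decide +kernel)).trans (by decide +kernel)

/-- **`c(W/ℚ_5) = 3` IN THE KERNEL** (the carrier's LOCAL Tamagawa number) for any globally minimal `W / ℚ` with this model: Tate's algorithm at `5` to its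
exit (type IV, `TamX` certificate, `c = 3`) through n1011-p19's bridge `IntModelTam.localTamagawaNumber_padic_eq_of_intModel_of_tamX`; the `hmono` input of the
mono-carrier road (`ord₃ ∏ c_ℓ = 1 = ord₃ c_5`). [cite: Silverman1994, IV.9.4] [cite: Tate1975, §7] [cite: Cremona2006, Table 1 (Cremona label 432900br1)] -/
theorem localTamagawa_five_432900br1 {W : WeierstrassCurve ℚ} [W.IsElliptic] [W.IsGloballyMinimal]
    (hI : integralModelInt W = (⟨0, 0, 0, -3600, -45900⟩ : WeierstrassCurve ℤ)) :
    haveI : Fact (Nat.Prime 5) := ⟨by norm_num⟩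
    (W.baseChange ℚ_[5]).localTamagawaNumber ℤ_[5] = 3 :=
  haveI : Fact (Nat.Prime 5) := ⟨by norm_num⟩
  (IntModelTam.localTamagawaNumber_padic_eq_of_intModel_of_tamX hI 5 (F := ⟨5, 2, 1, 0, 0, 0, 4, 2⟩) rfl (by decide +kernel)).trans (by decide)

/-- `Wd = [0, 0, 0, -7454595600, 136771329122100]` (the minimal model of the Heegner twist `432900br1^{(-1439)}`, conductor `896415120900`): `Δ ≠ 0` in the kernel. [cite: Cremona2006, Table 1 (Cremona label 432900br1)] -/
theorem isElliptic_sWd432900br1 : (⟨0, 0, 0, -7454595600, 136771329122100⟩ : WeierstrassCurve ℚ).IsElliptic :=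
  isElliptic_of_discOf_ne_zero 0 0 0 (-7454595600) 136771329122100 (by decide +kernel)

/-- `Wd` is globally minimal: `|Δ| = 2^8·3^6·5^4·13·37^2·1439^6` kernel-checked, Kraus' criterion prime by prime. [cite: Kraus1989, Prop. 1 and Prop. 2]
[cite: SilvermanAEC2009, VII.1 Remark 1.1] [cite: Cremona2006, Table 1 (Cremona label 432900br1)] -/
theorem isGloballyMinimal_sWd432900br1 : (⟨0, 0, 0, -7454595600, 136771329122100⟩ : WeierstrassCurve ℚ).IsGloballyMinimal :=
  isGloballyMinimal_of_krausCriterion₃_factored 0 0 0 (-7454595600) 136771329122100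
    [(2, 8), (3, 6), (5, 4), (13, 1), (37, 2), (1439, 6)] (by decide +kernel)
    (by intro qe hqe; simp only [List.mem_cons, List.not_mem_nil, or_false] at hqe
        rcases hqe with rfl | rfl | rfl | rfl | rfl | rfl <;> norm_num)
    (by set_option synthInstance.maxSize 2000 in decide +kernel)

/-- **U₁ AT `432900br1` BY THE MONO-CARRIER TWIST-UNIT ROAD** — `MissingUpperBoundAt W 3` (`ord₃ #Ш(E) ≤ ord₃ #Ш(E)_an`) at `W = E` from rhp-p2 g9 §4
`RamifiedPairUpperBound.leafRankOneUpper_three_monoCarrierAny_of_namedFacts_of_twistUnitTwoSplit` (p646214): PRINTED binders `hGZ hKo hGZK hmod hGZ73 hMN hCassels`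
(Gross–Zagier ∀, Kolyvagin ∀, GZK, Version L, GZ I.(7.3), Matar–Nekovář 2019 Thm 0.7 irreducible form, Cassels) and the three NAMED tree facts `h37 hPT hF1`
(GrossLMS1991 Prop. 3.7(2), Poitou–Tate for Selmer structures, Gross 1991 (4.1) — research-level inputs of the Jetchev any-carrier reading, displayed BY NAME);
KERNEL: `∏ c_ℓ(E) = 6` (`tamagawaProduct_432900br1`) and `c(E/ℚ_5) = 3` (`localTamagawa_five_432900br1`) so `hmono` holds with the single ADDITIVE carrier `q = 5` (IV),
`¬ CM` (`j = 44236800/17797` is none of the thirteen CM `j`-invariants), `Addv ∧ SubGss` at `3` (`subGss_three_432900br1`), the field `K = ℚ(√-1439)`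
(`-1439 ≡ 1 (mod 8)`: `2` and every `ℓ ∣ N` split; `1439` prime), the twist identity `Cd • E^{(-1439)} = Wd`
(`Cd = [1, 0, 0, 0]`) and Kraus minimality of `Wd` (`isGloballyMinimal_sWd432900br1`); DISPLAYED: `N(E) = 432900` (`hN`), `r_an(E) = 1` (`hr`), `Dt` with `3 ∤ c(Dt)`
(`hc`; Manin constant `1` for this optimal curve), `L(E^{(-1439)},1) ≠ 0` (`hLt`) and `#Ш(Wd)_an = 4` (`hqd`/`hvd`) — numerics in the section header.
NO S2, NO Σ, NO L₀.  A per-curve certificate; U₁ (stmt 26022) stays OPEN class-wide; BSD is NOT proved by this. [cite: MatarNekovar2019, Thm. 0.7 (p. 456) and §0.11]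
[cite: GrossZagier1986, Thm. I.(6.3) and (7.3)] [cite: GrossLMS1991, Prop. 3.7] [cite: Miller2011LMS, Def. 1.1] [cite: Cremona2006, Table 1 (Cremona label 432900br1)] -/
theorem u1_at_432900br1
    (hGZ : ∀ (N : ℕ) [NeZero N] (W : WeierstrassCurve ℚ) (K : Type) [Field K] [NumberField K], gross_zagier N W K)
    (hKo : ∀ (N : ℕ) [NeZero N] (W : WeierstrassCurve ℚ) (K : Type) [Field K] [NumberField K], kolyvagin N W K)
    (hGZK : rank_eq_analyticRank_of_analyticRank_le_one) (hmod : hasEntireLFunction_rat) (hGZ73 : GrossZagier1986_thm_I_7_3)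
    (hMN : MatarNekovar2019.thm07_padicValNat_card_sha_primary_add_le_of_globalDivisibility_of_irreducible)
    (hCassels : bsdRHS_eq_of_isIsogenous) (h37 : GrossLMS1991.prop37_2_frobeniusCongruence)
    (hPT : ∀ (K : Type) [Field K] [NumberField K], Literature.NumberTheory.GaloisCohomology.poitouTate_selmerStructure_duality_conj K)
    (hF1 : Gross1991_heegnerPoint_sub_ratTorsion_mem_E0_imageFree)
    {W : WeierstrassCurve ℚ} [W.IsElliptic] [W.IsGloballyMinimal] (hWeq : W = (⟨0, 0, 0, -3600, -45900⟩ : WeierstrassCurve ℚ))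
    (hN : W.conductorNorm ℤ = 432900) [NeZero (W.conductorNorm ℤ)] (hr : W.analyticRank = 1)
    (Dt : ModularParametrizationData W (W.conductorNorm ℤ)) (hc : ¬ (3 : ℤ) ∣ Dt.c)
    (hLt : (W.quadraticTwist ((-1439 : ℤ) : ℚ)).entireLFunction 1 ≠ 0)
    {qd : ℚ} (hqd : haveI := isElliptic_sWd432900br1; shaAn (⟨0, 0, 0, -7454595600, 136771329122100⟩ : WeierstrassCurve ℚ) = (qd : ℂ))
    (hvd : padicValRat 3 qd ≤ 0) :
    MissingUpperBoundAt W 3 := by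
  subst hWeq
  haveI := isElliptic_sWd432900br1; haveI := isGloballyMinimal_sWd432900br1
  haveI : Fact ((-1439 : ℤ) < 0) := ⟨by norm_num⟩
  haveI : Fact (Nat.Prime 5) := ⟨by norm_num⟩
  have hjac : ∀ ℓ : ℕ, ℓ.Prime → ℓ ∣ 432900 → ℓ ≠ 2 → jacobiSym (-1439) ℓ = 1 := by
    intro ℓ hℓ hℓN hℓ2
    have hmem : ℓ ∈ Nat.primeFactors 432900 := Nat.mem_primeFactors.mpr ⟨hℓ, hℓN, by norm_num⟩
    have hpf : Nat.primeFactors 432900 = {2, 3, 5, 13, 37} := by decide +kernel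
    rw [hpf] at hmem
    simp only [Finset.mem_insert, Finset.mem_singleton] at hmem
    rcases hmem with rfl | rfl | rfl | rfl | rfl
    · exact absurd rfl hℓ2
    all_goals (rw [jacobiSym.mod_left]; norm_num [jacobiSym.mod_left])
  have hWd : (⟨1, (0 : ℚ), (0 : ℚ), (0 : ℚ)⟩ : VariableChange ℚ) •
      (⟨0, 0, 0, -3600, -45900⟩ : WeierstrassCurve ℚ).quadraticTwist ((-1439 : ℤ) : ℚ) =
        (⟨0, 0, 0, -7454595600, 136771329122100⟩ : WeierstrassCurve ℚ) := by
    push_cast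
    ext <;> simp [WeierstrassCurve.variableChange_a₁, WeierstrassCurve.variableChange_a₂,
      WeierstrassCurve.variableChange_a₃, WeierstrassCurve.variableChange_a₄, WeierstrassCurve.variableChange_a₆,
      WeierstrassCurve.quadraticTwist, WeierstrassCurve.b₂, WeierstrassCurve.b₄, WeierstrassCurve.b₆] <;> norm_num
  have hTU := twistUnitTwoSplit_of_sqrtField _ 432900 (-1439) (by norm_num)
    (by rw [show (-1439 : ℤ).natAbs = 1439 by rfl, Nat.squarefree_iff_nodup_primeFactorsList (by norm_num)]; simp)
    hjac hN hLt _ _ hWd hqd hvd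
  have hI : integralModelInt (⟨0, 0, 0, -3600, -45900⟩ : WeierstrassCurve ℚ) = (⟨0, 0, 0, -3600, -45900⟩ : WeierstrassCurve ℤ) :=
    integralModelInt_eq_of_map_eq _ (map_mk_int 0 0 0 (-3600) (-45900))
  have hmono : padicValNat 3 (⟨0, 0, 0, -3600, -45900⟩ : WeierstrassCurve ℚ).tamagawaProduct ≤
      padicValNat 3 (((⟨0, 0, 0, -3600, -45900⟩ : WeierstrassCurve ℚ).baseChange ℚ_[5]).localTamagawaNumber ℤ_[5]) := by
    rw [tamagawaProduct_432900br1 hI, localTamagawa_five_432900br1 hI]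
    exact le_of_eq (IntModelTam.padicValNat_eq_padicValNat_of_eq_mul (m := 2) Nat.prime_three (by norm_num) (by norm_num) (by norm_num))
  have hqN : 5 ∣ (⟨0, 0, 0, -3600, -45900⟩ : WeierstrassCurve ℚ).conductorNorm ℤ := by rw [hN]; norm_num
  have hCM : ¬ (⟨0, 0, 0, -3600, -45900⟩ : WeierstrassCurve ℚ).HasCM := fun hCM ↦ by
    have hj := (WeierstrassCurve.hasCM_iff_j_mem_holds (⟨0, 0, 0, -3600, -45900⟩ : WeierstrassCurve ℚ)).1 hCM
    rw [WeierstrassCurve.j, Units.val_inv_eq_inv_val, WeierstrassCurve.coe_Δ'] at hj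
    simp only [cmJInvariants, Finset.mem_insert, Finset.mem_singleton] at hj
    norm_num [WeierstrassCurve.Δ, WeierstrassCurve.b₂, WeierstrassCurve.b₄, WeierstrassCurve.b₆, WeierstrassCurve.b₈,
      WeierstrassCurve.c₄] at hj
  have hGS := subGss_three_432900br1 (W := (⟨0, 0, 0, -3600, -45900⟩ : WeierstrassCurve ℚ)) rfl
  exact leafRankOneUpper_three_monoCarrierAny_of_namedFacts_of_twistUnitTwoSplit hGZ hKo hGZK hmod hGZ73 hMN hCassels h37 hPT hF1
    _ hCM hGS.1 hGS.2 hr 5 hqN hmono Dt hc hTU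

/-- **BSD₃ AT `432900br1` modulo print, the named facts and displayed numerics** — `BSDp W 3` from `u1_at_432900br1` (upper half) and the LOWER half read off the
displayed analytic order `#Ш(E)_an = q` with `ord₃ q ≤ 0` (Cremona: `#Ш(E)_an = 1`, so `ord₃ q ≤ 0 ≤ ord₃ #Ш(E)` is free), glued by `Typed.missingPPartAt_of_lower_of_upper`
+ `Typed.bsdp_of_missingPPartAt` (GZK).  Per curve, CONDITIONAL on every displayed input; nothing booked; BSD is NOT proved by this.
[cite: Miller2011LMS, Def. 1.1] [cite: MatarNekovar2019, Thm. 0.7 (p. 456)] [cite: Cremona2006, Table 1 (Cremona label 432900br1)] -/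
theorem bsd3_at_432900br1
    (hGZ : ∀ (N : ℕ) [NeZero N] (W : WeierstrassCurve ℚ) (K : Type) [Field K] [NumberField K], gross_zagier N W K)
    (hKo : ∀ (N : ℕ) [NeZero N] (W : WeierstrassCurve ℚ) (K : Type) [Field K] [NumberField K], kolyvagin N W K)
    (hGZK : rank_eq_analyticRank_of_analyticRank_le_one) (hmod : hasEntireLFunction_rat) (hGZ73 : GrossZagier1986_thm_I_7_3)
    (hMN : MatarNekovar2019.thm07_padicValNat_card_sha_primary_add_le_of_globalDivisibility_of_irreducible)
    (hCassels : bsdRHS_eq_of_isIsogenous) (h37 : GrossLMS1991.prop37_2_frobeniusCongruence)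
    (hPT : ∀ (K : Type) [Field K] [NumberField K], Literature.NumberTheory.GaloisCohomology.poitouTate_selmerStructure_duality_conj K)
    (hF1 : Gross1991_heegnerPoint_sub_ratTorsion_mem_E0_imageFree)
    {W : WeierstrassCurve ℚ} [W.IsElliptic] [W.IsGloballyMinimal] (hWeq : W = (⟨0, 0, 0, -3600, -45900⟩ : WeierstrassCurve ℚ))
    (hN : W.conductorNorm ℤ = 432900) [NeZero (W.conductorNorm ℤ)] (hr : W.analyticRank = 1)
    {q : ℚ} (hq : shaAn W = (q : ℂ)) (hv : padicValRat 3 q ≤ 0)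
    (Dt : ModularParametrizationData W (W.conductorNorm ℤ)) (hc : ¬ (3 : ℤ) ∣ Dt.c)
    (hLt : (W.quadraticTwist ((-1439 : ℤ) : ℚ)).entireLFunction 1 ≠ 0)
    {qd : ℚ} (hqd : haveI := isElliptic_sWd432900br1; shaAn (⟨0, 0, 0, -7454595600, 136771329122100⟩ : WeierstrassCurve ℚ) = (qd : ℂ))
    (hvd : padicValRat 3 qd ≤ 0) :
    BSDp W 3 := by
  have hup : MissingUpperBoundAt W 3 := u1_at_432900br1 hGZ hKo hGZK hmod hGZ73 hMN hCassels h37 hPT hF1 hWeq hN hr Dt hc hLt hqd hvd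
  have hlow : MissingLowerBoundAt W 3 := ⟨q, hq, hv.trans (by exact_mod_cast Nat.zero_le _)⟩
  exact Typed.bsdp_of_missingPPartAt _ 3 hGZK hr.le (Typed.missingPPartAt_of_lower_of_upper _ 3 hlow hup)

end Summit.BirchSwinnertonDyer.BirchSwinnertonDyer.Theorems.RamifiedHeegnerPairTwistUnitAdditive

end
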